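import Summits.Ventures.Crystal3D.Theorems.StickyWulffConstantGenericWallFloorRunCountUpper
import Summits.Ventures.Crystal3D.Theorems.StickyWulffConstantGenericWallFloorSlotCharts
import Summits.Ventures.Crystal3D.Theorems.StickyWulffConstantGenericWallFloorShellCount
import Summits.Ventures.Crystal3D.Theorems.StickyWulffConstantGenericWallFloorAffineSampleDeficit
import HarnessLib

/-!
# The clamped slab sample counts AT MOST its two flat faces: `D(P) ≤ 2 φ(A⁻¹e₃) π ρ² + C ρ`

HONEST FRAMING. Part of the venture `Summits/Ventures/Crystal3D` (cell `crystal3d-full`), helper for the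
crux `GenericWallFloor` (stmt-Ventures-19480) of `route-Ventures-StickyWulffConstant`, line `WallLedgerG`:
module M1 of the rigid-bicrystal rung of `stub_twoSlabAdhesion` (note RIGID-RUNG-ARCH on the item).  The
registered skeleton's inequality carries the clamped samples' deficiencies with a MINUS sign
(`cross − D(Y) = D(P₁) + D(P₂) − D(X)`), so the ledger needs the companion UPPER bound of the landed
`stub_affineSampleDeficit`:

**Theorem** (`affineSampleDeficit_upper`).  For every rigid motion `p ↦ A p + t` and `R ≥ 1` there is `C`
(depending on `A` and `R`) such that for every window `[a, b]`, `b − a = R`, every `ρ ≥ R` and the sample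
`P = (A·Λ₀ + t) ∩ {a ≤ p₂ ≤ b, p₀² + p₁² ≤ ρ²}`:  `D(P) ≤ 2 φ(A⁻¹ e₃) π ρ² + C ρ`.

Proof: pull back to `Λ₀` (offset `s = A⁻¹t`, normal `ν = A⁻¹e₃`); slot sum
`D = ½ Σ_{w} #{p : p + w ∉ P′}` (`…SlotSum`); a transversal slot contributes
`≤ √2|⟪w,ν⟫|π(ρ + K/|⟪w,ν⟫|)²` (`…RunCountUpper` with the chart of `…SlotCharts`), a horizontal slot
contributes `≤ 54(R+2)ρ` (its points `p + w` are rim balls of the moved sample: `…ShellCount`); and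
`½ √2 π Σ_w |⟪w,ν⟫| = 2φ(ν)π`.

WHAT THIS IS NOT: nothing about the crux stub beyond this module; rung F-C1 not moved.
-/

noncomputable section

namespace Summit.Ventures.Crystal3D.Theorems

open Summit.Ventures.Crystal3D Finset Matrix
open Literature.MathematicalPhysics.StatisticalMechanics (barlowPos fccStacking constHagg haggLabel_const
  barlowPos_mem isHaggSeq_const contactDeficiency le_dist_of_mem_barlowStacking_ideal)
open scoped InnerProductSpace

/-- The unit vectors of `Λ₀` are exactly the twelve slots. -/
theorem setOf_unit_fcc_eq_fccSlots :
    {w ∈ fccStacking 1 (Real.sqrt (2 / 3)) | ‖w‖ = 1} = (↑fccSlots : Set (EuclideanSpace ℝ (Fin 3))) := by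
  ext w
  simp only [Set.mem_setOf_eq, Finset.mem_coe]
  constructor
  · rintro ⟨hw, hn⟩
    have h0 : (0 : EuclideanSpace ℝ (Fin 3)) ∈ fccStacking 1 (Real.sqrt (2 / 3)) := by
      refine ⟨0, 0, 0, ?_⟩
      rw [barlowPos_fcc_linear 1 _ 0 0 0]; simp
    have := sub_mem_fccSlots_of_dist_eq_one h0 hw (by rw [dist_eq_norm, zero_sub, norm_neg, hn])
    simpa using this
  · intro hw
    exact ⟨mem_fcc_of_mem_fccSlots hw, norm_eq_one_of_mem_fccSlots hw⟩

/-- `φ`'s finsum is the plain sum over the twelve slots. -/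
theorem finsum_unit_fcc_eq_sum (ν : EuclideanSpace ℝ (Fin 3)) :
    ∑ᶠ w ∈ {w ∈ fccStacking 1 (Real.sqrt (2 / 3)) | ‖w‖ = 1}, |⟪w, ν⟫_ℝ| =
      ∑ w ∈ fccSlots, |⟪w, ν⟫_ℝ| := by
  rw [setOf_unit_fcc_eq_fccSlots, finsum_mem_coe_finset]

/-- **Upper bound for the clamped slab sample of a moved fcc lattice.** See the module docstring. -/
theorem affineSampleDeficit_upper
    (A : EuclideanSpace ℝ (Fin 3) ≃ₗᵢ[ℝ] EuclideanSpace ℝ (Fin 3)) (t : EuclideanSpace ℝ (Fin 3))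
    (R : ℝ) (hR : 1 ≤ R) : ∃ C : ℝ, ∀ a b : ℝ, b - a = R → ∀ ρ : ℝ, R ≤ ρ →
      ∀ P : Finset (EuclideanSpace ℝ (Fin 3)),
        (∀ p, p ∈ P ↔ (p ∈ (fun q => A q + t) '' fccStacking 1 (Real.sqrt (2 / 3)) ∧
          a ≤ p 2 ∧ p 2 ≤ b ∧ p 0 ^ 2 + p 1 ^ 2 ≤ ρ ^ 2)) →
        contactDeficiency P ≤
          2 * (Real.sqrt 2 / 4 * ∑ᶠ w ∈ {w ∈ fccStacking 1 (Real.sqrt (2 / 3)) | ‖w‖ = 1},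
            |⟪w, A.symm (EuclideanSpace.single (2 : Fin 3) (1 : ℝ))⟫_ℝ|) * Real.pi * ρ ^ 2 + C * ρ := by
  classical
  set e₃ : EuclideanSpace ℝ (Fin 3) := EuclideanSpace.single (2 : Fin 3) (1 : ℝ) with he₃
  set ν : EuclideanSpace ℝ (Fin 3) := A.symm e₃ with hν
  set s : EuclideanSpace ℝ (Fin 3) := A.symm t with hs
  set K : ℝ := R / 2 + 4 with hK
  set cst : EuclideanSpace ℝ (Fin 3) → ℝ := fun w =>
    if ⟪w, ν⟫_ℝ = 0 then 54 * (R + 2)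
    else 2 * Real.sqrt 2 * Real.pi * K + Real.sqrt 2 * Real.pi * K ^ 2 / |⟪w, ν⟫_ℝ| with hcst
  refine ⟨1 / 2 * ∑ w ∈ fccSlots, cst w, ?_⟩
  intro a b hab ρ hρ P hP
  have hρ1 : 1 ≤ ρ := hR.trans hρ
  have hρ0 : 0 ≤ ρ := by linarith
  have hR0 : 0 ≤ R := by linarith
  have he₃n : ‖e₃‖ = 1 := by rw [he₃, PiLp.norm_single, norm_one]
  have hνn : ‖ν‖ = 1 := by rw [hν, LinearIsometryEquiv.norm_map, he₃n]
  have hAν : A ν = e₃ := by rw [hν, LinearIsometryEquiv.apply_symm_apply]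
  have hAs : A s = t := by rw [hs, LinearIsometryEquiv.apply_symm_apply]
  -- the motion, its inverse, coordinates (as in `stub_affineSampleDeficit`)
  set g : EuclideanSpace ℝ (Fin 3) → EuclideanSpace ℝ (Fin 3) := fun q => A q + t with hg
  set ginv : EuclideanSpace ℝ (Fin 3) → EuclideanSpace ℝ (Fin 3) := fun p => A.symm (p - t) with hginv
  have hg_ginv : ∀ p, g (ginv p) = p := by
    intro p; simp only [hg, hginv, LinearIsometryEquiv.apply_symm_apply]; abel
  have hginv_g : ∀ q, ginv (g q) = q := by
    intro q; simp only [hg, hginv, add_sub_cancel_right, LinearIsometryEquiv.symm_apply_apply]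
  have hginv_iso : Isometry ginv := by
    intro p q; simp only [hginv, edist_dist, LinearIsometryEquiv.dist_map, dist_sub_right]
  have hgq : ∀ q, g q = A (q + s) := by intro q; simp only [hg, map_add, hAs]
  have h2 : ∀ q, g q 2 = ⟪q + s, ν⟫_ℝ := by
    intro q
    have : g q 2 = ⟪g q, e₃⟫_ℝ := by rw [he₃, EuclideanSpace.inner_single_right]; simp
    rw [this, hgq, ← hAν, LinearIsometryEquiv.inner_map_map]
  have hlat : ∀ q, g q 0 ^ 2 + g q 1 ^ 2 = ‖q + s‖ ^ 2 - ⟪q + s, ν⟫_ℝ ^ 2 := by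
    intro q
    rw [sq_add_sq_eq_norm_sq_sub, ← he₃, hgq, LinearIsometryEquiv.norm_map, ← hAν,
      LinearIsometryEquiv.inner_map_map]
  -- the pulled-back sample
  set P' : Finset (EuclideanSpace ℝ (Fin 3)) := P.image ginv with hP'
  have hmemP' : ∀ q, q ∈ P' ↔ g q ∈ P := by
    intro q; rw [hP', mem_image]
    constructor
    · rintro ⟨p, hp, rfl⟩; rw [hg_ginv]; exact hp
    · intro hq; exact ⟨g q, hq, hginv_g q⟩
  have himg : ∀ q, g q ∈ (fun q => A q + t) '' fccStacking 1 (Real.sqrt (2 / 3)) ↔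
      q ∈ fccStacking 1 (Real.sqrt (2 / 3)) := by
    intro q; constructor
    · rintro ⟨q', hq', hqq'⟩
      have : q' = q := by
        have h1 : ginv (g q') = ginv (g q) := congrArg ginv hqq'
        rwa [hginv_g, hginv_g] at h1
      rw [← this]; exact hq'
    · intro hq; exact ⟨q, hq, rfl⟩
  have hP'iff : ∀ q, q ∈ P' ↔ (q ∈ fccStacking 1 (Real.sqrt (2 / 3)) ∧ a ≤ ⟪q + s, ν⟫_ℝ ∧
      ⟪q + s, ν⟫_ℝ ≤ a + R ∧ ‖q + s‖ ^ 2 - ⟪q + s, ν⟫_ℝ ^ 2 ≤ ρ ^ 2) := by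
    intro q; rw [hmemP', hP (g q), h2, hlat, ← hab, add_sub_cancel, himg]
  have hP'fcc : ∀ q ∈ P', q ∈ fccStacking 1 (Real.sqrt (2 / 3)) := fun q hq => ((hP'iff q).1 hq).1
  have hDP : contactDeficiency P = contactDeficiency P' := by
    rw [hP', contactDeficiency_image_of_isometry hginv_iso]
  -- the slot sum
  rw [hDP, contactDeficiency_eq_half_sum_card_empty P' hP'fcc]
  -- per-slot bounds
  have hslot : ∀ w ∈ fccSlots, ((P'.filter fun p => p + w ∉ P').card : ℝ) ≤
      Real.sqrt 2 * |⟪w, ν⟫_ℝ| * Real.pi * ρ ^ 2 + cst w * ρ := by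
    intro w hw
    by_cases hα : ⟪w, ν⟫_ℝ = 0
    · -- horizontal slot: the points `g (p + w)` are rim balls of the moved sample
      have hcw : cst w = 54 * (R + 2) := by simp only [hcst, hα, if_true]
      rw [hcw, hα, abs_zero, mul_zero, zero_mul, zero_mul, zero_add]
      set F := P'.filter fun p => p + w ∉ P' with hF
      set S := F.image fun q => g (q + w) with hS
      have hinjS : Set.InjOn (fun q => g (q + w)) ↑F := by
        intro q _ q' _ h
        have h1 := congrArg ginv h
        simp only [hginv_g] at h1
        exact add_right_cancel h1
      have hcardS : (F.card : ℝ) = (S.card : ℝ) := by rw [hS, card_image_of_injOn hinjS]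
      -- separation and shell membership of `S`
      have hwn : ‖w‖ = 1 := norm_eq_one_of_mem_fccSlots hw
      have hSsep : ∀ x ∈ S, ∀ y ∈ S, x ≠ y → 1 ≤ dist x y := by
        intro x hx y hy hxy
        obtain ⟨q, hq, rfl⟩ := mem_image.1 hx
        obtain ⟨q', hq', rfl⟩ := mem_image.1 hy
        have hqf := hP'fcc q (mem_filter.1 hq).1
        have hq'f := hP'fcc q' (mem_filter.1 hq').1
        have hne : q + w ≠ q' + w := by
          intro h; apply hxy; rw [h]
        rw [hgq, hgq, LinearIsometryEquiv.dist_map, dist_add_right]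
        exact le_dist_of_mem_barlowStacking_ideal isHaggSeq_const one_pos fcc_height_sq
          (add_mem_fcc_of_mem_fccSlots hqf hw) (add_mem_fcc_of_mem_fccSlots hq'f hw) hne
      have hSmem : ∀ x ∈ S, a ≤ x 2 ∧ x 2 ≤ b ∧ ρ ^ 2 < x 0 ^ 2 + x 1 ^ 2 ∧
          x 0 ^ 2 + x 1 ^ 2 ≤ (ρ + 1) ^ 2 := by
        intro x hx
        obtain ⟨q, hq, rfl⟩ := mem_image.1 hx
        obtain ⟨hqP, hqw⟩ := mem_filter.1 hq
        obtain ⟨hqf, h1, h2q, h3⟩ := (hP'iff q).1 hqP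
        have hinw : ⟪q + w + s, ν⟫_ℝ = ⟪q + s, ν⟫_ℝ := by
          rw [show q + w + s = (q + s) + w by abel, inner_add_left, hα, add_zero]
        rw [h2, hlat, hinw]
        refine ⟨h1, by linarith, ?_, ?_⟩
        · -- `q + w ∉ P'` although it is a site in the window: the lateral condition fails
          by_contra hle
          push Not at hle
          apply hqw
          rw [hP'iff]
          exact ⟨add_mem_fcc_of_mem_fccSlots hqf hw, by rw [hinw]; exact h1, by rw [hinw]; exact h2q,
            by rw [hinw]; exact hle⟩
        · -- lateral parts add: `‖(x + w)_lat‖ ≤ ‖x_lat‖ + ‖w_lat‖ ≤ ρ + 1`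
          rw [← hinw, ← norm_sub_inner_smul_sq ν _ hνn]
          have hx3 : ‖(q + s) - ⟪q + s, ν⟫_ℝ • ν‖ ≤ ρ := by
            have : ‖(q + s) - ⟪q + s, ν⟫_ℝ • ν‖ ^ 2 ≤ ρ ^ 2 := by
              rw [norm_sub_inner_smul_sq ν _ hνn]; exact h3
            exact (pow_le_pow_iff_left₀ (norm_nonneg _) hρ0 two_ne_zero).1 this
          have hw3 : ‖w - ⟪w, ν⟫_ℝ • ν‖ ≤ 1 := by
            rw [hα, zero_smul, sub_zero, hwn]
          have hsplit : (q + w + s) - ⟪q + w + s, ν⟫_ℝ • ν =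
              ((q + s) - ⟪q + s, ν⟫_ℝ • ν) + (w - ⟪w, ν⟫_ℝ • ν) := by
            rw [show q + w + s = (q + s) + w by abel, inner_add_left, add_smul]; abel
          rw [hsplit]
          have hle : ‖((q + s) - ⟪q + s, ν⟫_ℝ • ν) + (w - ⟪w, ν⟫_ℝ • ν)‖ ≤ ρ + 1 :=
            (norm_add_le _ _).trans (add_le_add hx3 hw3)
          exact pow_le_pow_left₀ (norm_nonneg _) hle 2
      have hshell := card_mul_le_of_separated_in_shell S hSsep a b ρ (ρ + 1) (by linarith) hρ1
        (by linarith) hSmem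
      rw [hcardS]
      have hbma : b - a + 2 = R + 2 := by rw [hab]
      rw [hbma] at hshell
      have hring : (R + 2) * (Real.pi * (ρ + 1 + 1) ^ 2 - Real.pi * (ρ - 1) ^ 2) =
          Real.pi * ((R + 2) * (6 * ρ + 3)) := by ring
      rw [hring] at hshell
      have hS' : (S.card : ℝ) ≤ 6 * ((R + 2) * (6 * ρ + 3)) := by
        by_contra hcon
        push Not at hcon
        nlinarith [Real.pi_pos, hshell, hcon]
      nlinarith [hS', hρ1, hR0]
    · -- transversal slot: the chart and the line count
      obtain ⟨Ea, Eb, hEa, hEb, hdet, fa, fb, ft, hchart⟩ := exists_chart_of_mem_fccSlots hw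
      have hcw : cst w = 2 * Real.sqrt 2 * Real.pi * K + Real.sqrt 2 * Real.pi * K ^ 2 / |⟪w, ν⟫_ℝ| := by
        simp only [hcst, hα, if_false]
      have hcount := card_filter_add_notMem_le_lineCount ν s hνn a R ρ hR0 hρ0 P' hP'iff Ea Eb w
        hEa hEb (norm_eq_one_of_mem_fccSlots hw) hdet hα hw fa fb ft hchart
      rw [hcw]
      have hαpos : 0 < |⟪w, ν⟫_ℝ| := abs_pos.2 hα
      -- `√2|α|π(ρ + K/|α|)² = √2|α|πρ² + 2√2πKρ + √2πK²/|α| ≤ … ρ`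
      have hexp : Real.sqrt 2 * |⟪w, ν⟫_ℝ| * Real.pi * (ρ + (R / 2 + 4) / |⟪w, ν⟫_ℝ|) ^ 2 =
          Real.sqrt 2 * |⟪w, ν⟫_ℝ| * Real.pi * ρ ^ 2 + 2 * Real.sqrt 2 * Real.pi * K * ρ +
            Real.sqrt 2 * Real.pi * K ^ 2 / |⟪w, ν⟫_ℝ| := by
        rw [← hK]; field_simp; ring
      rw [hexp] at hcount
      have hK0 : 0 ≤ Real.sqrt 2 * Real.pi * K ^ 2 / |⟪w, ν⟫_ℝ| := by positivity
      nlinarith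
  -- sum the per-slot bounds
  have hsum : ∑ w ∈ fccSlots, ((P'.filter fun p => p + w ∉ P').card : ℝ) ≤
      ∑ w ∈ fccSlots, (Real.sqrt 2 * |⟪w, ν⟫_ℝ| * Real.pi * ρ ^ 2 + cst w * ρ) :=
    sum_le_sum hslot
  rw [finsum_unit_fcc_eq_sum]
  have hrew : ∑ w ∈ fccSlots, (Real.sqrt 2 * |⟪w, ν⟫_ℝ| * Real.pi * ρ ^ 2 + cst w * ρ) =
      Real.sqrt 2 * Real.pi * ρ ^ 2 * ∑ w ∈ fccSlots, |⟪w, ν⟫_ℝ| + ρ * ∑ w ∈ fccSlots, cst w := by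
    rw [sum_add_distrib, mul_sum, mul_sum]
    congr 1 <;> refine sum_congr rfl fun w _ => by ring
  rw [hrew] at hsum
  have hfinal : 1 / 2 * ∑ w ∈ fccSlots, ((P'.filter fun p => p + w ∉ P').card : ℝ) ≤
      1 / 2 * (Real.sqrt 2 * Real.pi * ρ ^ 2 * ∑ w ∈ fccSlots, |⟪w, ν⟫_ℝ| +
        ρ * ∑ w ∈ fccSlots, cst w) := by linarith
  refine hfinal.trans (le_of_eq ?_)
  ring

end Summit.Ventures.Crystal3D.Theorems

end
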